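import Summits.RiemannHypothesis.RiemannHypothesis.Theorems.MotivicDoorAWSForcingReduction
import Literature.NumberTheory.LFunctions.WeilWindowSuzukiContinuityProofs

/-!
# AWS sprint, TEST-CLASS-DOWN (1/3): window bookkeeping, increments and the pole form

HONEST LABEL.  One-way implication from a strengthened, prime-side-only axiom system; the existence
of an `ArithmeticWeilSurface` is NOT claimed and is the located gap; the converse (RH ⇒ existence) is
NOT a harder statement: satisfiability of the axiom list is EQUIVALENT to RH — the canonical carrier
written down from prime-side data satisfies every axiom except `hodge`, and on it `hodge` IS Weil
positivity on a dense class — so the hypothesis is tautological rather than informative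
(`AXIOM-CONTENT.md` §2, referee-signed 2026-08-19; kernel form `riemannHypothesis_iff_exists_tautologicalCarrier`,
`Theorems/MotivicDoor/AWS/Tautological.lean`).  [Docstring corrected 2026-08-19T22:1xZ: the earlier clause
"not expected to be provable" was false for this axiom system, REFEREE-1 B39.]  Framing: lottery
ticket at the motivic door; RH probability negligible; consolation prizes are real: a new semi-local
Weil-positivity theorem, or a located gap in the Connes–Consani programme, plus the ff-door theorem.

Position-space estimates for real Weil test functions supported in a window `[-R, R]`:
sup bounds, the increment `D_t`, the `λ`-trick `|A² − B²| ≤ (A − B)²/λ + (λ/2)(A² + B²)`,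
and the `ε`-continuity of the pole form `P(g) = 2|∫ g cosh(t/2)|² − 2|∫ g sinh(t/2)|²` (L1, L3, L4 of
the forcing-down plan).  No zeros of `ζ` are used.
-/

noncomputable section

open Complex Set MeasureTheory Filter Literature.NumberTheory.LFunctions
open Literature.NumberTheory.ConnesConsani2019
open Summit.RiemannHypothesis.RiemannHypothesis.Theorems.MotivicDoor.ConnesConsani
open scoped BigOperators Real ArithmeticFunction.vonMangoldt

namespace Summit.RiemannHypothesis.RiemannHypothesis.Theorems.MotivicDoor.AWS


/-! ## Window bookkeeping -/

/-- A function vanishing off `[a, b]` and bounded by `M ≥ 0` has integral at most `M (b - a)`. -/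
theorem integral_le_of_eq_zero_off_Icc {F : ℝ → ℝ} {a b M : ℝ} (hab : a ≤ b) (hM : 0 ≤ M)
    (hF : ∀ x, F x ≤ M) (hzero : ∀ x, x ∉ Icc a b → F x = 0) :
    ∫ x, F x ≤ M * (b - a) := by
  rw [← setIntegral_eq_integral_of_forall_compl_eq_zero hzero]
  by_cases hint : IntegrableOn F (Icc a b)
  · calc ∫ x in Icc a b, F x ≤ ∫ x in Icc a b, M :=
          integral_mono hint (integrable_const M) fun x ↦ hF x
      _ = M * (b - a) := by
          rw [setIntegral_const, Real.volume_real_Icc_of_le hab, smul_eq_mul, mul_comm]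
  · rw [integral_undef hint]; exact mul_nonneg hM (by linarith)

/-- Sup bound of a test function. -/
theorem exists_forall_abs_le_of_isWeilTest {u : ℝ → ℝ} (hu : IsWeilTest fun t ↦ (u t : ℂ)) :
    ∃ S : ℝ, 0 ≤ S ∧ ∀ t, |u t| ≤ S := by
  obtain ⟨C, hC⟩ := hu.1.continuous.bounded_above_of_compact_support hu.2
  refine ⟨max C 0, le_max_right _ _, fun t ↦ ?_⟩
  have := hC t
  rw [Complex.norm_real, Real.norm_eq_abs] at this
  exact this.trans (le_max_left _ _)

/-- The real function underlying a real test function is smooth with compact support. -/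
theorem contDiff_of_isWeilTest {u : ℝ → ℝ} (hu : IsWeilTest fun t ↦ (u t : ℂ)) :
    ContDiff ℝ (⊤ : ℕ∞) u := by
  have h := hu.1
  have : u = fun t ↦ (Complex.reCLM ((u t : ℂ))) := by funext t; simp
  rw [this]
  exact Complex.reCLM.contDiff.comp h

/-- A real Weil test function has compact support. -/
theorem hasCompactSupport_of_isWeilTest {u : ℝ → ℝ} (hu : IsWeilTest fun t ↦ (u t : ℂ)) :
    HasCompactSupport u := by
  have h := hu.2
  have : u = fun t ↦ (Complex.reCLM ((u t : ℂ))) := by funext t; simp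
  rw [this]
  exact h.comp_left (g := fun z : ℂ ↦ Complex.reCLM z) (by simp)

/-- Sup bound of the derivative of a test function. -/
theorem exists_forall_abs_deriv_le_of_isWeilTest {u : ℝ → ℝ} (hu : IsWeilTest fun t ↦ (u t : ℂ)) :
    ∃ S' : ℝ, 0 ≤ S' ∧ ∀ t, |deriv u t| ≤ S' := by
  have hc : Continuous (deriv u) :=
    (contDiff_of_isWeilTest hu).continuous_deriv (by simp)
  have hs : HasCompactSupport (deriv u) := (hasCompactSupport_of_isWeilTest hu).deriv
  obtain ⟨C, hC⟩ := hc.bounded_above_of_compact_support hs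
  refine ⟨max C 0, le_max_right _ _, fun t ↦ ?_⟩
  have := hC t
  rw [Real.norm_eq_abs] at this
  exact this.trans (le_max_left _ _)

/-- If `tsupport u ⊆ [-R, R]` then `u` vanishes off `[-R, R]`. -/
theorem eq_zero_of_tsupport_subset {u : ℝ → ℝ} {R : ℝ} (hsupp : tsupport u ⊆ Icc (-R) R) {x : ℝ}
    (hx : x ∉ Icc (-R) R) : u x = 0 :=
  image_eq_zero_of_notMem_tsupport fun h ↦ hx (hsupp h)

/-! ## Increment bounds (L4) -/

/-- **Lipschitz increment bound**: if `|w'| ≤ S'` everywhere and `tsupport w ⊆ [-R, R]` (`R ≥ 0`),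
then `D_t(w) ≤ (S' t)² (2R + 2|t|)`. -/
theorem weilIncrement_le_of_deriv_le {w : ℝ → ℝ} (hw : IsWeilTest fun t ↦ (w t : ℂ)) {R S' : ℝ}
    (hR : 0 ≤ R) (hsupp : tsupport w ⊆ Icc (-R) R) (hder : ∀ x, |deriv w x| ≤ S') (t : ℝ) :
    weilIncrement (fun x ↦ (w x : ℂ)) t ≤ (S' * t) ^ 2 * (2 * R + 2 * |t|) := by
  have hdiff : Differentiable ℝ w := (contDiff_of_isWeilTest hw).differentiable (by simp)
  have hlip : ∀ x, |w (x + t) - w x| ≤ S' * |t| := by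
    intro x
    have h := Convex.norm_image_sub_le_of_norm_deriv_le (f := w) (s := univ) (x := x) (y := x + t)
      (fun y _ ↦ hdiff y) (fun y _ ↦ by rw [Real.norm_eq_abs]; exact hder y) convex_univ
      (mem_univ _) (mem_univ _)
    simpa [Real.norm_eq_abs] using h
  unfold weilIncrement
  have hpt : ∀ x, ‖((w (x + t) : ℝ) : ℂ) - (w x : ℂ)‖ ^ 2 ≤ (S' * t) ^ 2 := by
    intro x
    rw [← Complex.ofReal_sub, Complex.norm_real, Real.norm_eq_abs]
    calc |w (x + t) - w x| ^ 2 ≤ (S' * |t|) ^ 2 :=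
          pow_le_pow_left₀ (abs_nonneg _) (hlip x) 2
      _ = (S' * t) ^ 2 := by rw [mul_pow, mul_pow, sq_abs]
  have hzero : ∀ x, x ∉ Icc (-R - |t|) (R + |t|) →
      ‖((w (x + t) : ℝ) : ℂ) - (w x : ℂ)‖ ^ 2 = 0 := by
    intro x hx
    have hx1 : x ∉ Icc (-R) R := by
      intro h; exact hx ⟨by linarith [h.1, abs_nonneg t], by linarith [h.2, abs_nonneg t]⟩
    have hx2 : x + t ∉ Icc (-R) R := by
      intro h
      exact hx ⟨by linarith [h.1, le_abs_self t], by linarith [h.2, neg_abs_le t]⟩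
    rw [eq_zero_of_tsupport_subset hsupp hx1, eq_zero_of_tsupport_subset hsupp hx2]
    simp
  calc ∫ x, ‖((w (x + t) : ℝ) : ℂ) - (w x : ℂ)‖ ^ 2
      ≤ (S' * t) ^ 2 * (R + |t| - (-R - |t|)) :=
        integral_le_of_eq_zero_off_Icc (by linarith [abs_nonneg t]) (by positivity) hpt hzero
    _ = (S' * t) ^ 2 * (2 * R + 2 * |t|) := by ring

/-- **Window `L²` bound**: if `|w| ≤ S` everywhere and `tsupport w ⊆ [-R, R]` (`R ≥ 0`), then
`‖w‖₂² ≤ S² · 2R`. -/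
theorem integral_norm_sq_le_of_abs_le {w : ℝ → ℝ} {R S : ℝ} (hR : 0 ≤ R)
    (hsupp : tsupport w ⊆ Icc (-R) R) (hbd : ∀ x, |w x| ≤ S) :
    ∫ x, ‖(w x : ℂ)‖ ^ 2 ≤ S ^ 2 * (2 * R) := by
  have hpt : ∀ x, ‖(w x : ℂ)‖ ^ 2 ≤ S ^ 2 := by
    intro x
    rw [Complex.norm_real, Real.norm_eq_abs]
    exact pow_le_pow_left₀ (abs_nonneg _) (hbd x) 2
  have hzero : ∀ x, x ∉ Icc (-R) R → ‖(w x : ℂ)‖ ^ 2 = 0 := by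
    intro x hx
    rw [eq_zero_of_tsupport_subset hsupp hx]; simp
  calc ∫ x, ‖(w x : ℂ)‖ ^ 2 ≤ S ^ 2 * (R - -R) :=
        integral_le_of_eq_zero_off_Icc (by linarith) (by positivity) hpt hzero
    _ = S ^ 2 * (2 * R) := by ring

/-- **Crude increment bound**: `D_t(w) ≤ 4‖w‖₂² ≤ 8 R S²`. -/
theorem weilIncrement_le_of_abs_le {w : ℝ → ℝ} (hw : IsWeilTest fun t ↦ (w t : ℂ)) {R S : ℝ}
    (hR : 0 ≤ R) (hsupp : tsupport w ⊆ Icc (-R) R) (hbd : ∀ x, |w x| ≤ S) (t : ℝ) :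
    weilIncrement (fun x ↦ (w x : ℂ)) t ≤ 8 * R * S ^ 2 := by
  have h1 := weilIncrement_le hw t
  have h2 := integral_norm_sq_le_of_abs_le hR hsupp hbd
  calc weilIncrement (fun x ↦ (w x : ℂ)) t ≤ 4 * ∫ x, ‖(w x : ℂ)‖ ^ 2 := h1
    _ ≤ 4 * (S ^ 2 * (2 * R)) := by gcongr
    _ = 8 * R * S ^ 2 := by ring

/-! ## Difference of increments (L3, `λ`-form) -/

/-- Pointwise: `| |A|² − |B|² | ≤ |A − B|²/λ + (λ/2)(|A|² + |B|²)` for `λ > 0`. -/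
theorem abs_sq_sub_sq_le_div_add (A B : ℝ) {lam : ℝ} (hlam : 0 < lam) :
    |A ^ 2 - B ^ 2| ≤ (A - B) ^ 2 / lam + lam / 2 * (A ^ 2 + B ^ 2) := by
  have key : lam * |A ^ 2 - B ^ 2| ≤ (A - B) ^ 2 + lam ^ 2 / 2 * (A ^ 2 + B ^ 2) := by
    rcases le_or_gt 0 (A ^ 2 - B ^ 2) with h | h
    · rw [abs_of_nonneg h]
      nlinarith [sq_nonneg ((A - B) - lam * (A + B) / 2), sq_nonneg (lam * (A - B))]
    · rw [abs_of_neg h]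
      nlinarith [sq_nonneg ((A - B) + lam * (A + B) / 2), sq_nonneg (lam * (A - B))]
  have h2 : (A - B) ^ 2 / lam + lam / 2 * (A ^ 2 + B ^ 2) =
      ((A - B) ^ 2 + lam ^ 2 / 2 * (A ^ 2 + B ^ 2)) / lam := by
    field_simp
  rw [h2, le_div_iff₀ hlam, mul_comm]
  exact key

/-- The increment of a real function as a real integral: `D_t(w) = ∫ (w(x+t) − w(x))² dx`. -/
theorem weilIncrement_ofReal_eq (w : ℝ → ℝ) (t : ℝ) :
    weilIncrement (fun x ↦ (w x : ℂ)) t = ∫ x, (w (x + t) - w x) ^ 2 := by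
  unfold weilIncrement
  congr 1
  funext x
  rw [← Complex.ofReal_sub, Complex.norm_real, Real.norm_eq_abs, sq_abs]

/-- Integrability of the real increment integrand of a test function. -/
theorem integrable_sub_sq_of_isWeilTest {w : ℝ → ℝ} (hw : IsWeilTest fun t ↦ (w t : ℂ)) (t : ℝ) :
    Integrable fun x ↦ (w (x + t) - w x) ^ 2 := by
  have h := integrable_weilIncrement_integrand hw.memLp_two t
  refine h.congr (Eventually.of_forall fun x ↦ ?_)
  simp only
  rw [← Complex.ofReal_sub, Complex.norm_real, Real.norm_eq_abs, sq_abs]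

/-- A real difference of real test functions is a real test function. -/
theorem isWeilTest_sub_ofReal {u v : ℝ → ℝ} (hu : IsWeilTest fun t ↦ (u t : ℂ))
    (hv : IsWeilTest fun t ↦ (v t : ℂ)) : IsWeilTest fun t ↦ ((u t - v t : ℝ) : ℂ) := by
  have h := hu.sub hv
  convert h using 1
  funext t
  simp only [Pi.sub_apply]
  push_cast
  ring

/-- **Difference of increments, `λ`-form (L3)**: for real test functions `u, v`, every `t` and
every `λ > 0`, `|D_t(u) − D_t(v)| ≤ D_t(u − v)/λ + (λ/2)(D_t(u) + D_t(v))`. -/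
theorem abs_weilIncrement_sub_le {u v : ℝ → ℝ} (hu : IsWeilTest fun t ↦ (u t : ℂ))
    (hv : IsWeilTest fun t ↦ (v t : ℂ)) (t : ℝ) {lam : ℝ} (hlam : 0 < lam) :
    |weilIncrement (fun x ↦ (u x : ℂ)) t - weilIncrement (fun x ↦ (v x : ℂ)) t| ≤
      weilIncrement (fun x ↦ ((u x - v x : ℝ) : ℂ)) t / lam +
        lam / 2 * (weilIncrement (fun x ↦ (u x : ℂ)) t + weilIncrement (fun x ↦ (v x : ℂ)) t) := by
  have hw := isWeilTest_sub_ofReal hu hv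
  rw [weilIncrement_ofReal_eq u, weilIncrement_ofReal_eq v, weilIncrement_ofReal_eq (fun x ↦ u x - v x)]
  have hiu := integrable_sub_sq_of_isWeilTest hu t
  have hiv := integrable_sub_sq_of_isWeilTest hv t
  have hiw := integrable_sub_sq_of_isWeilTest hw t
  rw [← integral_sub hiu hiv]
  have hpt : ∀ x, |(u (x + t) - u x) ^ 2 - (v (x + t) - v x) ^ 2| ≤
      ((u (x + t) - v (x + t)) - (u x - v x)) ^ 2 / lam +
        lam / 2 * ((u (x + t) - u x) ^ 2 + (v (x + t) - v x) ^ 2) := by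
    intro x
    have h := abs_sq_sub_sq_le_div_add (u (x + t) - u x) (v (x + t) - v x) hlam
    have he : (u (x + t) - u x - (v (x + t) - v x)) = (u (x + t) - v (x + t)) - (u x - v x) := by ring
    rwa [he] at h
  have hm1 : Integrable fun x ↦ ((u (x + t) - v (x + t)) - (u x - v x)) ^ 2 / lam := by
    exact hiw.div_const lam
  have hm2 : Integrable fun x ↦ lam / 2 * ((u (x + t) - u x) ^ 2 + (v (x + t) - v x) ^ 2) := by
    exact (hiu.add hiv).const_mul (lam / 2)
  have hmaj : Integrable fun x ↦ ((u (x + t) - v (x + t)) - (u x - v x)) ^ 2 / lam +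
      lam / 2 * ((u (x + t) - u x) ^ 2 + (v (x + t) - v x) ^ 2) := by
    exact hm1.add hm2
  calc |∫ x, ((u (x + t) - u x) ^ 2 - (v (x + t) - v x) ^ 2)|
      ≤ ∫ x, |(u (x + t) - u x) ^ 2 - (v (x + t) - v x) ^ 2| := abs_integral_le_integral_abs
    _ ≤ ∫ x, (((u (x + t) - v (x + t)) - (u x - v x)) ^ 2 / lam +
          lam / 2 * ((u (x + t) - u x) ^ 2 + (v (x + t) - v x) ^ 2)) :=
        integral_mono (hiu.sub hiv).abs hmaj hpt
    _ = (∫ x, ((u (x + t) - v (x + t)) - (u x - v x)) ^ 2) / lam +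
          lam / 2 * ((∫ x, (u (x + t) - u x) ^ 2) + ∫ x, (v (x + t) - v x) ^ 2) := by
        rw [integral_add hm1 hm2, integral_div, integral_const_mul, integral_add hiu hiv]

/-! ## The pole form (L1) -/

/-- A window integral of a real function against a kernel bounded by `C` on the window:
`|∫ g k| ≤ S C · 2R`. -/
theorem abs_integral_mul_le_window {g k : ℝ → ℝ} {R S C : ℝ} (hR : 0 ≤ R)
    (hsupp : tsupport g ⊆ Icc (-R) R) (hS : 0 ≤ S) (hbd : ∀ x, |g x| ≤ S) (hC : 0 ≤ C)
    (hk : ∀ t ∈ Icc (-R) R, |k t| ≤ C) :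
    |∫ t, g t * k t| ≤ S * C * (2 * R) := by
  refine abs_integral_le_integral_abs.trans ?_
  have hF : ∀ t, |g t * k t| ≤ S * C := by
    intro t
    by_cases ht : t ∈ Icc (-R) R
    · rw [abs_mul]; exact mul_le_mul (hbd t) (hk t ht) (abs_nonneg _) hS
    · rw [eq_zero_of_tsupport_subset hsupp ht]; simp; positivity
  have hzero : ∀ t, t ∉ Icc (-R) R → |g t * k t| = 0 := by
    intro t ht; rw [eq_zero_of_tsupport_subset hsupp ht]; simp
  calc ∫ t, |g t * k t| ≤ S * C * (R - -R) :=
        integral_le_of_eq_zero_off_Icc (by linarith) (by positivity) hF hzero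
    _ = S * C * (2 * R) := by ring

/-- The kernels `cosh(t/2)`, `sinh(t/2)` are bounded by `cosh(R/2)` on `[-R, R]`. -/
theorem abs_cosh_half_le {R t : ℝ} (ht : t ∈ Icc (-R) R) :
    |Real.cosh (t / 2)| ≤ Real.cosh (R / 2) := by
  rw [abs_of_pos (Real.cosh_pos _)]
  refine Real.cosh_le_cosh.2 ?_
  have h1 : |t / 2| ≤ R / 2 := by
    rw [abs_le]; constructor <;> linarith [ht.1, ht.2]
  exact h1.trans (le_abs_self _)

/-- `|sinh(t/2)| ≤ cosh(R/2)` on the window `[-R, R]`. -/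
theorem abs_sinh_half_le {R t : ℝ} (ht : t ∈ Icc (-R) R) :
    |Real.sinh (t / 2)| ≤ Real.cosh (R / 2) := by
  rw [Real.abs_sinh]
  refine (Real.sinh_lt_cosh _).le.trans ?_
  rw [Real.cosh_abs]
  exact (le_abs_self _).trans (abs_cosh_half_le ht)

/-- The pole form of a real test function in terms of two real window integrals. -/
theorem weilPoleForm_ofReal_eq (g : ℝ → ℝ) :
    weilPoleForm (fun t ↦ (g t : ℂ)) =
      2 * (∫ t, g t * Real.cosh (t / 2)) ^ 2 - 2 * (∫ t, g t * Real.sinh (t / 2)) ^ 2 := by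
  unfold weilPoleForm
  have h1 : (fun t ↦ (g t : ℂ) * (Real.cosh (t / 2) : ℂ)) = fun t ↦ ((g t * Real.cosh (t / 2) : ℝ) : ℂ) := by
    funext t; push_cast; ring
  have h2 : (fun t ↦ (g t : ℂ) * (Real.sinh (t / 2) : ℂ)) = fun t ↦ ((g t * Real.sinh (t / 2) : ℝ) : ℂ) := by
    funext t; push_cast; ring
  rw [h1, h2, integral_complex_ofReal, integral_complex_ofReal, Complex.norm_real, Complex.norm_real,
    Real.norm_eq_abs, Real.norm_eq_abs, sq_abs, sq_abs]

/-- Integrability of `g · k` for a real test function `g` and a continuous kernel `k`. -/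
theorem integrable_mul_of_isWeilTest {g : ℝ → ℝ} (hg : IsWeilTest fun t ↦ (g t : ℂ)) {k : ℝ → ℝ}
    (hk : Continuous k) : Integrable fun t ↦ g t * k t :=
  ((contDiff_of_isWeilTest hg).continuous.mul hk).integrable_of_hasCompactSupport
    ((hasCompactSupport_of_isWeilTest hg).mul_right)

/-- **Pole-form continuity (L1)**: with `|u| ≤ S`, `|u − v| ≤ ε ≤ 1` on the window `[-R, R]`,
`|P(u) − P(v)| ≤ 4 ε (cosh(R/2) · 2R)² (2S + 1)`. -/
theorem abs_weilPoleForm_sub_le {u v : ℝ → ℝ} (hu : IsWeilTest fun t ↦ (u t : ℂ))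
    (hv : IsWeilTest fun t ↦ (v t : ℂ)) {R S ε : ℝ} (hR : 0 ≤ R) (hsuppu : tsupport u ⊆ Icc (-R) R)
    (hsuppv : tsupport v ⊆ Icc (-R) R) (hS : 0 ≤ S) (hbd : ∀ x, |u x| ≤ S) (hε : 0 ≤ ε)
    (hε1 : ε ≤ 1) (hclose : ∀ t, |u t - v t| ≤ ε) :
    |weilPoleForm (fun t ↦ (u t : ℂ)) - weilPoleForm (fun t ↦ (v t : ℂ))| ≤
      4 * ε * (Real.cosh (R / 2) * (2 * R)) ^ 2 * (2 * S + 1) := by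
  set C : ℝ := Real.cosh (R / 2) with hCdef
  have hC : 0 ≤ C := (Real.cosh_pos _).le
  have hbdv : ∀ x, |v x| ≤ S + 1 := by
    intro x
    have h1 := hbd x; have h2 := hclose x
    have h3 : |v x| ≤ |u x| + |u x - v x| := by
      have := abs_sub_abs_le_abs_sub (v x) (u x)
      rw [abs_sub_comm] at this
      linarith
    linarith
  have hsuppw : tsupport (fun x ↦ u x - v x) ⊆ Icc (-R) R :=
    (tsupport_sub u v).trans (union_subset hsuppu hsuppv) |>.trans' (by intro x hx; simpa using hx)
  have key : ∀ k : ℝ → ℝ, Continuous k → (∀ t ∈ Icc (-R) R, |k t| ≤ C) →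
      |(∫ t, u t * k t) ^ 2 - (∫ t, v t * k t) ^ 2| ≤ ε * (C * (2 * R)) ^ 2 * (2 * S + 1) := by
    intro k hk hkb
    have hau := abs_integral_mul_le_window hR hsuppu hS hbd hC hkb
    have hav := abs_integral_mul_le_window hR hsuppv (by positivity) hbdv hC hkb
    have haw := abs_integral_mul_le_window (g := fun x ↦ u x - v x) hR hsuppw hε hclose hC hkb
    have hlin : (∫ t, u t * k t) - ∫ t, v t * k t = ∫ t, (u t - v t) * k t := by
      rw [← integral_sub (integrable_mul_of_isWeilTest hu hk) (integrable_mul_of_isWeilTest hv hk)]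
      congr 1; funext t; ring
    rw [sq_sub_sq, abs_mul, mul_comm, hlin]
    calc |∫ t, (u t - v t) * k t| * |(∫ t, u t * k t) + ∫ t, v t * k t|
        ≤ (ε * C * (2 * R)) * (S * C * (2 * R) + (S + 1) * C * (2 * R)) := by
          refine mul_le_mul haw ((abs_add_le _ _).trans (add_le_add hau hav)) (abs_nonneg _)
            (by positivity)
      _ = ε * (C * (2 * R)) ^ 2 * (2 * S + 1) := by ring
  have hcosh := key (fun t ↦ Real.cosh (t / 2)) (Real.continuous_cosh.comp (continuous_id.div_const 2))
    fun t ht ↦ abs_cosh_half_le ht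
  have hsinh := key (fun t ↦ Real.sinh (t / 2)) (Real.continuous_sinh.comp (continuous_id.div_const 2))
    fun t ht ↦ abs_sinh_half_le ht
  rw [weilPoleForm_ofReal_eq, weilPoleForm_ofReal_eq]
  have hE : ∀ a b c d : ℝ, (2 * a - 2 * b) - (2 * c - 2 * d) = 2 * (a - c) - 2 * (b - d) :=
    fun a b c d ↦ by ring
  rw [hE]
  calc |2 * ((∫ t, u t * Real.cosh (t / 2)) ^ 2 - (∫ t, v t * Real.cosh (t / 2)) ^ 2) -
        2 * ((∫ t, u t * Real.sinh (t / 2)) ^ 2 - (∫ t, v t * Real.sinh (t / 2)) ^ 2)|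
      ≤ |2 * ((∫ t, u t * Real.cosh (t / 2)) ^ 2 - (∫ t, v t * Real.cosh (t / 2)) ^ 2)| +
        |2 * ((∫ t, u t * Real.sinh (t / 2)) ^ 2 - (∫ t, v t * Real.sinh (t / 2)) ^ 2)| :=
        abs_sub _ _
    _ ≤ 2 * (ε * (C * (2 * R)) ^ 2 * (2 * S + 1)) + 2 * (ε * (C * (2 * R)) ^ 2 * (2 * S + 1)) := by
        rw [abs_mul, abs_mul, abs_two]
        gcongr
    _ = 4 * ε * (C * (2 * R)) ^ 2 * (2 * S + 1) := by ring

end Summit.RiemannHypothesis.RiemannHypothesis.Theorems.MotivicDoor.AWS
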